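import Literature.NumberTheory.GaloisRepresentations.PhiGammaModuleRobba
import HarnessLib

/-!
# `(φ, Γ)`-modules over the Robba ring: proofs about graded classes and non-splitness

Companion proof file of `Literature.NumberTheory.GaloisRepresentations.PhiGammaModuleRobba`
(nothing there is restated).  That file attaches to a triangulation `T` of a `(φ, Γ)`-module
`M` (adapted basis `e_0, …, e_{n-1}`, based parameters `(α_i, c_i)`) and a consecutive pair
`(i, i+1)` the off-diagonal entries `x_i = e_i^*(φ e_{i+1})` (`phiCoeff`),
`y_i(γ) = e_i^*(γ e_{i+1})` (`actCoeff`), the representative cocycle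
`(x_i α_{i+1}⁻¹, y_i(γ₀) c_{i+1}(γ₀)⁻¹)` (`gradedCocycle`, a cocycle of the Herr complex of
`𝓡(δ_i δ_{i+1}⁻¹)` by `gradedCocycle_mem_Z1`), its class `c_i ∈ H¹_{φ,γ₀}(𝓡(δ_iδ_{i+1}⁻¹))`
(`gradedClass`) and the predicate `IsNonSplitAt T γ₀ i hi := c_i ≠ 0` — Ding's hypothesis
"`D_i^{i+1}` is non-split" on a trianguline `D` [Ding, *Simple `𝓛`-invariants for `GL_n`*, §3.1].

## Main results

* `gradedClass_eq_zero_iff`, `isNonSplitAt_iff`, `not_isNonSplitAt_iff_exists`: the class `c_i`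
  vanishes iff the representative cocycle is a coboundary of `𝓡(δ_iδ_{i+1}⁻¹)`, i.e. iff there is
  `z ∈ 𝓡` with `(α_iα_{i+1}⁻¹) φ(z) - z = x_i α_{i+1}⁻¹` and
  `(c_ic_{i+1}⁻¹)(γ₀) γ₀(z) - z = y_i(γ₀) c_{i+1}(γ₀)⁻¹` (the change of lift
  `e_{i+1} ↦ e_{i+1} + z e_i` splitting the extension).
* `not_isNonSplitAt_of_coeff_eq_zero`, `IsNonSplitAt.coeff_ne_zero`: a triangulation that is
  block-diagonal at `(i, i+1)` for `φ` and `γ₀` (`x_i = 0 = y_i(γ₀)`) is split there.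
* `ofTriangular_phiCoeff`, `ofTriangular_actCoeff`: for an upper-triangular FRAMED module
  (`Triangulation.ofTriangular` of the dictionary with `Trianguline.lean`) the graded coefficients
  are the super-diagonal matrix entries `P_{i,i+1}`, `G(γ)_{i,i+1}`.
* `FramedPhiGammaModule.trivial_isTriangularWith_one`, `ofTriangular_trivial_not_isNonSplitAt`,
  `not_forall_isNonSplitAt`: the trivial framed module `𝓡ⁿ` (`P = 1`, `G(γ) = 1`) is
  triangulated with unit parameters and is split at EVERY step; so over every `(φ, Γ)`-ring the
  universal closure of `IsNonSplitAt` fails.  `IsNonSplitAt` is thus a CONDITION on a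
  triangulated module (a hypothesis predicate, like `IsStrictAt`), not a closed named fact: there
  is no `IsNonSplitAt_holds`.

## References

* Y. Ding, *Simple `𝓛`-invariants for `GL_n`*, Trans. AMS 372 (2019), arXiv:1807.10862 — §3.1
  (the non-split hypothesis on `D_i^{i+1}` and the class `[D_i^{i+1}] ∈ H¹`). [Ding2019SimpleL]
* K. S. Kedlaya, J. Pottharst, L. Xiao, *Cohomology of arithmetic families of `(φ, Γ)`-modules*,
  JAMS 27 (2014), arXiv:1203.5718 — Def. 2.3.3 (Herr complex), Def. 6.3.1 (triangulations).
  [KedlayaPottharstXiao2014]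

## Mathlib / Literature declarations used

From `PhiGammaModuleRobba.lean`: `PhiGammaModule.Triangulation` (+ `phiCoeff`, `actCoeff`,
`ratioParam`, `gradedCocycle`, `gradedCocycle_mem_Z1`, `gradedClass`, `IsNonSplitAt`,
`ofTriangular`, `basisFun_coord_apply`), `Herr.mem_B1_iff`, `PhiGammaRing.RankOneDatum.toModule`
(+ `toModule_phi_apply`, `toModule_act_apply`, `one_α`, `one_c`),
`FramedPhiGammaModule.toPhiGammaModule` (+ `phiOp_single`, `gammaOp_single`); from
`Trianguline.lean`: `FramedPhiGammaModule.trivial`, `IsTriangularWith`.  Mathlib: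
`Submodule.Quotient.mk_eq_zero`, `Submodule.mem_comap`, `Matrix.blockTriangular_one`,
`Matrix.one_apply_ne`, `Pi.basisFun_apply`.
-/

noncomputable section

namespace Literature.NumberTheory.GaloisRepresentations

universe u v w x

namespace PhiGammaModule.Triangulation

variable {Γ : Type u} [Group Γ] {E : Type v} [CommRing E] {𝓡 : PhiGammaRing.{u, v, w} Γ E}
  {D : Type x} [AddCommGroup D] [Module 𝓡.R D] {M : PhiGammaModule 𝓡 D} {n : ℕ}
  (T : M.Triangulation n) (γ₀ : Γ) (i : ℕ) (hi : i + 1 < n)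

/-! ### When is the graded class zero? -/

/-- The class `c_i` of the graded piece `(i, i+1)` vanishes iff its representative cocycle
`(x_i α_{i+1}⁻¹, y_i(γ₀) c_{i+1}(γ₀)⁻¹)` is a coboundary of the Herr complex of
`𝓡(δ_i δ_{i+1}⁻¹)`. [folklore] -/
theorem gradedClass_eq_zero_iff :
    T.gradedClass γ₀ i hi = 0 ↔ T.gradedCocycle γ₀ i hi ∈ (T.ratioParam i hi).toModule.B1 γ₀ := by
  rw [gradedClass, Submodule.Quotient.mk_eq_zero, Submodule.mem_comap, Submodule.subtype_apply]

/-- `IsNonSplitAt` unfolded: the graded piece `(i, i+1)` is non-split iff its representative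
cocycle is not a coboundary of `𝓡(δ_i δ_{i+1}⁻¹)`. [folklore] -/
theorem isNonSplitAt_iff :
    T.IsNonSplitAt γ₀ i hi ↔ T.gradedCocycle γ₀ i hi ∉ (T.ratioParam i hi).toModule.B1 γ₀ :=
  (T.gradedClass_eq_zero_iff γ₀ i hi).not

/-- **Splitting in coordinates**: the graded piece `(i, i+1)` is split (its class vanishes) iff
there is `z ∈ 𝓡` with `(α_i α_{i+1}⁻¹) φ(z) - z = x_i α_{i+1}⁻¹` and
`(c_i c_{i+1}⁻¹)(γ₀) γ₀(z) - z = y_i(γ₀) c_{i+1}(γ₀)⁻¹` — the coboundary equation `d⁰ z = `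
graded cocycle in `𝓡(δ_i δ_{i+1}⁻¹)`, i.e. the new lift `e_{i+1} + z e_i` of the basis vector of
the quotient is fixed by `(φ - α_{i+1}, γ₀ - c_{i+1}(γ₀))` modulo `Fil_i`. [folklore] -/
theorem not_isNonSplitAt_iff_exists :
    ¬ T.IsNonSplitAt γ₀ i hi ↔ ∃ z : 𝓡.R,
      ((T.ratioParam i hi).α : 𝓡.R) * 𝓡.frob z - z = (T.gradedCocycle γ₀ i hi).1 ∧
        ((T.ratioParam i hi).c γ₀ : 𝓡.R) * γ₀ • z - z = (T.gradedCocycle γ₀ i hi).2 := by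
  rw [isNonSplitAt_iff, not_not, Herr.mem_B1_iff]
  simp only [phiₗ_apply, actₗ_apply, PhiGammaRing.RankOneDatum.toModule_phi_apply,
    PhiGammaRing.RankOneDatum.toModule_act_apply, Prod.ext_iff]

/-- If the adapted basis is block-diagonal at `(i, i+1)` for `φ` and for `γ₀`
(`x_i = e_i^*(φ e_{i+1}) = 0` and `y_i(γ₀) = e_i^*(γ₀ e_{i+1}) = 0`), the representative cocycle
of the graded piece is `0`. [folklore] -/
theorem gradedCocycle_eq_zero_of_coeff_eq_zero (hx : T.phiCoeff i hi = 0)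
    (hy : T.actCoeff i hi γ₀ = 0) : T.gradedCocycle γ₀ i hi = 0 := by
  ext <;> simp [gradedCocycle, hx, hy]

/-- **Block-diagonal implies split**: if `x_i = 0` and `y_i(γ₀) = 0` then the graded piece
`(i, i+1)` is NOT non-split (its class is the class of the zero cocycle). [folklore] -/
theorem not_isNonSplitAt_of_coeff_eq_zero (hx : T.phiCoeff i hi = 0)
    (hy : T.actCoeff i hi γ₀ = 0) : ¬ T.IsNonSplitAt γ₀ i hi := by
  rw [isNonSplitAt_iff, not_not, T.gradedCocycle_eq_zero_of_coeff_eq_zero γ₀ i hi hx hy]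
  exact Submodule.zero_mem _

/-- A non-split graded piece has a non-zero off-diagonal entry: `x_i ≠ 0` or `y_i(γ₀) ≠ 0`.
[folklore] -/
theorem IsNonSplitAt.coeff_ne_zero {T : M.Triangulation n} {γ₀ : Γ} {i : ℕ} {hi : i + 1 < n}
    (h : T.IsNonSplitAt γ₀ i hi) : T.phiCoeff i hi ≠ 0 ∨ T.actCoeff i hi γ₀ ≠ 0 := by
  by_contra h'
  rw [not_or, not_ne_iff, not_ne_iff] at h'
  exact T.not_isNonSplitAt_of_coeff_eq_zero γ₀ i hi h'.1 h'.2 h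

/-! ### Graded coefficients of an upper-triangular framed module -/

/-- For an upper-triangular framed module triangulated in the standard basis
(`Triangulation.ofTriangular`), `x_i = e_i^*(φ e_{i+1})` is the super-diagonal entry `P_{i,i+1}`
of the matrix of `φ`. [folklore] -/
theorem ofTriangular_phiCoeff (F : FramedPhiGammaModule 𝓡 n) (d : Fin n → 𝓡.RankOneDatum)
    (hF : F.IsTriangularWith (fun j => ((d j).α : 𝓡.R)) (fun j γ => ((d j).c γ : 𝓡.R)))
    (i : ℕ) (hi : i + 1 < n) :
    (ofTriangular F d hF).phiCoeff i hi =
      (F.matPhi : Matrix (Fin n) (Fin n) 𝓡.R) ⟨i, Nat.lt_of_succ_lt hi⟩ ⟨i + 1, hi⟩ := by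
  show (Pi.basisFun 𝓡.R (Fin n)).coord _ (F.toPhiGammaModule.phi (Pi.basisFun 𝓡.R (Fin n) _)) = _
  rw [basisFun_coord_apply, Pi.basisFun_apply, FramedPhiGammaModule.toPhiGammaModule_phi_apply,
    FramedPhiGammaModule.phiOp_single]

/-- For an upper-triangular framed module triangulated in the standard basis,
`y_i(γ) = e_i^*(γ e_{i+1})` is the super-diagonal entry `G(γ)_{i,i+1}` of the matrix of `γ`.
[folklore] -/
theorem ofTriangular_actCoeff (F : FramedPhiGammaModule 𝓡 n) (d : Fin n → 𝓡.RankOneDatum)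
    (hF : F.IsTriangularWith (fun j => ((d j).α : 𝓡.R)) (fun j γ => ((d j).c γ : 𝓡.R)))
    (i : ℕ) (hi : i + 1 < n) (γ : Γ) :
    (ofTriangular F d hF).actCoeff i hi γ =
      (F.matGamma γ : Matrix (Fin n) (Fin n) 𝓡.R) ⟨i, Nat.lt_of_succ_lt hi⟩ ⟨i + 1, hi⟩ := by
  show (Pi.basisFun 𝓡.R (Fin n)).coord _
      (F.toPhiGammaModule.act γ (Pi.basisFun 𝓡.R (Fin n) _)) = _
  rw [basisFun_coord_apply, Pi.basisFun_apply, FramedPhiGammaModule.toPhiGammaModule_act_apply,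
    FramedPhiGammaModule.gammaOp_single]

/-! ### The split example: the trivial framed module `𝓡ⁿ` -/

/-- The trivial framed module `𝓡ⁿ` (`P = 1`, `G(γ) = 1`) is upper triangular with the unit
data `(α_i, c_i) = (1, 1)` on the diagonal: it is the direct sum `𝓡 ⊕ ⋯ ⊕ 𝓡` of unit objects.
[folklore] -/
theorem _root_.Literature.NumberTheory.GaloisRepresentations.FramedPhiGammaModule.trivial_isTriangularWith_one
    (𝓡 : PhiGammaRing.{u, v, w} Γ E) (n : ℕ) :
    (FramedPhiGammaModule.trivial 𝓡 n).IsTriangularWith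
      (fun _ => ((1 : 𝓡.RankOneDatum).α : 𝓡.R)) (fun _ γ => ((1 : 𝓡.RankOneDatum).c γ : 𝓡.R)) := by
  refine ⟨?_, fun j => ?_, fun γ => ⟨?_, fun j => ?_⟩⟩
  · rw [FramedPhiGammaModule.trivial_matPhi, Units.val_one]
    exact Matrix.blockTriangular_one
  · simp
  · rw [FramedPhiGammaModule.trivial_matGamma, Units.val_one]
    exact Matrix.blockTriangular_one
  · simp

/-- **The split triangulation**: the trivial framed module `𝓡ⁿ`, triangulated in its standard
basis with unit parameters, is NOT non-split at any step `(i, i+1)` (all super-diagonal entries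
of `P = 1` and `G(γ₀) = 1` vanish, so every graded class is `0`). [folklore] -/
theorem ofTriangular_trivial_not_isNonSplitAt (𝓡 : PhiGammaRing.{u, v, w} Γ E) (γ₀ : Γ) {n : ℕ}
    (i : ℕ) (hi : i + 1 < n) :
    ¬ (ofTriangular (FramedPhiGammaModule.trivial 𝓡 n) (fun _ => (1 : 𝓡.RankOneDatum))
        (FramedPhiGammaModule.trivial_isTriangularWith_one 𝓡 n)).IsNonSplitAt γ₀ i hi := by
  have hne : (⟨i, Nat.lt_of_succ_lt hi⟩ : Fin n) ≠ ⟨i + 1, hi⟩ := by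
    simp [Fin.ext_iff]
  refine not_isNonSplitAt_of_coeff_eq_zero _ γ₀ i hi ?_ ?_
  · rw [ofTriangular_phiCoeff, FramedPhiGammaModule.trivial_matPhi, Units.val_one,
      Matrix.one_apply_ne hne]
  · rw [ofTriangular_actCoeff, FramedPhiGammaModule.trivial_matGamma, Units.val_one,
      Matrix.one_apply_ne hne]

/-- **`IsNonSplitAt` is a condition, not a theorem.**  Over every `(φ, Γ)`-ring `𝓡`, for every
`γ₀ ∈ Γ` and every step `i + 1 < n`, it is NOT the case that all rank-`n` triangulated
`(φ, Γ)`-modules are non-split at `(i, i+1)`: the split module `𝓡ⁿ` is a counterexample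
(`ofTriangular_trivial_not_isNonSplitAt`).  Hence the universal closure of the predicate
`Triangulation.IsNonSplitAt` is false and it has no `_holds` discharge: in the source, "`D_i^{i+1}`
is non-split" is a HYPOTHESIS on the trianguline `(φ, Γ)`-module `D` (under which the simple
`𝓛`-invariants are defined), not an assertion. [cite: Ding2019SimpleL, §3.1] -/
theorem not_forall_isNonSplitAt (𝓡 : PhiGammaRing.{u, v, w} Γ E) (γ₀ : Γ) {n : ℕ} (i : ℕ)
    (hi : i + 1 < n) :
    ¬ ∀ (D : Type w) [AddCommGroup D] [Module 𝓡.R D] (M : PhiGammaModule 𝓡 D)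
        (T : M.Triangulation n), T.IsNonSplitAt γ₀ i hi :=
  fun h => ofTriangular_trivial_not_isNonSplitAt 𝓡 γ₀ i hi (h _ _ _)

end PhiGammaModule.Triangulation

end Literature.NumberTheory.GaloisRepresentations
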